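import Literature.Analysis.FluidPDE.LocalLeraySolutionsSlab
import Literature.Analysis.FluidPDE.WeakGradientIBP
import HarnessLib

/-!
# Local energy solutions on a finite strip `Q_T = ℝ³ × (0, T)` with weak continuity in time
(Seregin 2014, Def. B.1 = Kikuchi–Seregin 2007; Kang–Miura–Tsai 2021, Def. 3.1)

Analysis/FluidPDE definition file, companion of `LocalLeraySolutionsSlab.lean` (the tree's
finite-slab local Leray solutions `IsLocalLeraySolutionOn T ν v₀ v π`: Kang–Miura–Tsai Def. 3.2
on `(0, T)`, i.e. Lemarié-Rieusset's Def. 14.1 class) and of `LocalLeraySolutions.lean` (the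
global class on `(0, ∞)`). Seregin's proofs of the `L³` blow-up criterion (Comm. Math. Phys. 312
(2012); *Lecture notes*, 2014, Ch. 7 and Appendix B) and Lemarié-Rieusset's Ch. 15 (Prop. 15.1:
`u ∈ C([0, T₀], H^{-3/2}_uloc)`; Thm. 15.4: "`u(T₁, .)` is well defined", p. 568) use local
energy solutions **together with their values at every time of the closed interval `[0, T]`**,
pinned by weak continuity in time — Seregin 2014, Def. B.1, (B.1.6): "the function
`t ↦ ∫ v(x,t)·w(x) dx` is continuous on `[0,T]` for any compactly supported `w ∈ L₂`"; Ch. 7,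
(7.3.8): continuous on `[-S, 0]`; this is Kang–Miura–Tsai's Def. 3.1, property (6). The slab
class of `LocalLeraySolutionsSlab.lean` (KMT Def. 3.2) has no such clause. This file vendors the
strengthened class under Seregin's name:

> **Seregin 2014, Def. B.1** (= Kikuchi–Seregin 2007, Def. 1.1; Kang–Miura–Tsai 2021,
> Def. 3.1): a pair `(v, p)` on `Q_T = ℝ³ × ]0, T[` is a *local energy solution* if
> `v ∈ L_∞(0,T; L_{2,unif})`, `∇v ∈ L_{2,unif}(0,T)`, `p ∈ L_{3/2}(0,T; L_{3/2,loc})` (B.1.4);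
> `v, p` satisfy the equations in the sense of distributions (B.1.5); `t ↦ ∫ v(x,t)·w(x) dx` is
> continuous on `[0,T]` for every compactly supported `w ∈ L₂` (B.1.6); `‖v(·,t) − a‖_{L₂(K)} → 0`
> as `t → +0` for every compact `K` (B.1.7); the local energy inequality (B.1.8); the local
> pressure expansion (B.1.9).

as the structure `IsLocalEnergySolutionOn T ν v₀ v π`, rendered over the tree's notions
(`IsSuitableWeakSolutionOn` on the open slab for (B.1.5)+(B.1.8); `HasWeakSpatialGradientOn`;
`frobeniusNormSq`) with (B.1.4) at *every* time of `[0, T]` (legitimate under (B.1.6) by weak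
lower semicontinuity, and convenient: the final slice `v T` is an honest `L²_loc` field), (B.1.6)
with smooth compactly supported test fields (equivalent to compactly supported `L²` fields under
the uniform local `L²` bound, by density), every slice measurable, and — as in the two accepted
local-Leray files — Jia–Šverák's decay (7) in place of the pressure expansion (B.1.9) (equivalent
for these classes: Kang–Miura–Tsai, Lemmas 3.3–3.4; Kikuchi–Seregin, Lemma 2.2). Lemarié-Rieusset's
local Leray solutions (Def. 14.1: uloc classes, suitable, `L²(K)` attainment of the datum — no
(B.1.6)) become local energy solutions in this sense after the usual modification on a null set
of times (KMT, remark after Def. 3.1; his Prop. 15.1 asserts `u ∈ C([0,T₀], H^{-3/2}_uloc)`).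

Also **proved**: the projection onto the slab class `IsLocalEnergySolutionOn.isLocalLeraySolutionOn`
(Def. B.1 ⇒ KMT Def. 3.2 on `(0,T)`: the uniform bounds for every radius `R` and the square
integrability on `(0,T) × K` follow from the every-time unit-ball bound by covering an `R`-ball
or a compact set by finitely many unit balls and Tonelli), restriction to a shorter strip
(`mono`), slice-level API (`memLp_two_ball`, `locallyIntegrable_slice`, `integrable_inner_slice`),
and non-vacuity (`isLocalEnergySolutionOn_zero`). Consistency note: (B.1.6) at `t = 0` with
(B.1.7) forces `v 0 = v₀` a.e.; named facts quoted over this class in a *hypothesis* position are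
thereby weaker than the printed local-Leray statements, and facts producing such solutions assert
the weakly continuous representative (to be said in their docstrings).

## References

* G. Seregin, *Lecture Notes on Regularity Theory for the Navier–Stokes Equations*, World
  Scientific (2014), doi:10.1142/9314: Appendix B, Def. B.1 ((B.1.4)–(B.1.9)), Remarks B.3–B.4;
  Ch. 7, (7.3.6)–(7.3.12).
* N. Kikuchi, G. Seregin, AMS Transl. (2) 220 (2007), 141–164, Def. 1.1, Lemma 2.2.
* K. Kang, H. Miura, T.-P. Tsai, IMRN 2021 = arXiv:1812.10509, §3, Def. 3.1, Def. 3.2,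
  Lemmas 3.3–3.4 and the remark after Def. 3.1.
* P. G. Lemarié-Rieusset, *The Navier–Stokes Problem in the 21st Century* (2016), Def. 14.1
  (PDF pp. 498–499), Prop. 15.1 (p. 559), §15.3 (p. 568).
-/

noncomputable section

open MeasureTheory TopologicalSpace Set Function Filter Metric
open _root_.Topology
open scoped ENNReal NNReal RealInnerProductSpace

namespace Literature.Analysis.FluidPDE

/-! ## The definition -/

/-- **Local energy solutions on the finite strip `Q_T = ℝ³ × (0, T)`, with weak continuity in
time** (Seregin 2014, **Def. B.1** = Kikuchi–Seregin 2007, Def. 1.1; Kang–Miura–Tsai 2021,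
Def. 3.1 on `(0, T)`; Lemarié-Rieusset's local Leray solutions of Def. 14.1 after modification on
a null set of times). `(v, π)` is a local energy solution of the unforced Navier–Stokes equations
with viscosity `ν` and datum `v₀` on `ℝ³ × (0, T)`: (B.1.5)+(B.1.8) `(v, π)` is a suitable weak
solution on the open slab `(0, T) × ℝ³` (distributional solution with explicit pressure, local
energy classes, `π ∈ L^{3/2}_loc`, Caffarelli–Kohn–Nirenberg local energy inequality) with
`π ∈ L^{3/2}_loc(ℝ³ × [0, T])` ((B.1.4)); every slice `v t`, `t ∈ [0, T]`, is measurable with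
`sup_{t ∈ [0,T]} sup_{x₀} ∫_{B(x₀,1)} |v(t)|² < ∞` ((B.1.4) `v ∈ L^∞(0,T; L_{2,unif})`, at
every time by (B.1.6)); `v` has a weak spatial gradient `G` on the slab with
`sup_{x₀} ∫₀ᵀ ∫_{B(x₀,1)} |G|² < ∞` ((B.1.4) `∇v ∈ L_{2,unif}(0,T)`); (B.1.6) `t ↦ ∫⟪v(t), φ⟫`
is continuous on the **closed** interval `[0, T]` for every smooth compactly supported field
`φ`; (B.1.7) `∫_K |v(t) − v₀|² → 0` as `t → 0⁺` for compact `K`; and Jia–Šverák's decay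
`∫₀ᵀ ∫_{B_R(x₀)} |v|² → 0` as `|x₀| → ∞` for every `R > 0` (in place of the pressure expansion
(B.1.9), see the module docstring). The hypotheses `v₀ ∈ L²_uloc`, `div v₀ = 0` are not bundled.
Projects onto the slab class `IsLocalLeraySolutionOn` (`IsLocalEnergySolutionOn.isLocalLeraySolutionOn`).
[cite: Seregin2014, Def. B.1 (B.1.4)–(B.1.8)] [cite: KangMiuraTsai2020, Def. 3.1 and Def. 3.2 (7)] -/
structure IsLocalEnergySolutionOn (T : ℝ) (ν : ℝ)
    (v₀ : EuclideanSpace ℝ (Fin 3) → EuclideanSpace ℝ (Fin 3))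
    (v : ℝ → EuclideanSpace ℝ (Fin 3) → EuclideanSpace ℝ (Fin 3))
    (π : ℝ → EuclideanSpace ℝ (Fin 3) → ℝ) : Prop where
  /-- (B.1.5), (B.1.8): `(v, π)` is a suitable weak solution (CKN) of the unforced equations on
  the open slab `(0, T) × ℝ³`. -/
  suitable : IsSuitableWeakSolutionOn
    (slab (EuclideanSpace ℝ (Fin 3)) (Ioo 0 T) isOpen_Ioo) ν 0 v π
  /-- (B.1.4): `π ∈ L^{3/2}(0, T; L^{3/2}_loc)`, i.e. `∫₀ᵀ ∫_K |π|^{3/2} < ∞` for compact `K`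
  (up to both time ends). -/
  pressure : ∀ K : Set (EuclideanSpace ℝ (Fin 3)), IsCompact K →
    ∫⁻ z in Ioo 0 T ×ˢ K, ‖π z.1 z.2‖ₑ ^ (3 / 2 : ℝ) < ∞
  /-- Every slice `v t`, `t ∈ [0, T]`, is (a.e. strongly) measurable. -/
  sliceMeasurable : ∀ t ∈ Icc 0 T, AEStronglyMeasurable (v t) volume
  /-- (B.1.4), first half, at every time (by (B.1.6)):
  `sup_{0 ≤ t ≤ T} sup_{x₀} ∫_{B(x₀,1)} |v(x,t)|² dx < ∞`. -/
  uniformLocalEnergy : ∃ C : ℝ≥0, ∀ t ∈ Icc 0 T, ∀ x₀ : EuclideanSpace ℝ (Fin 3),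
    ∫⁻ x in ball x₀ 1, ‖v t x‖ₑ ^ 2 ≤ C
  /-- (B.1.4), second half: `v` has a weak spatial gradient `G = ∇v` on the slab with
  `sup_{x₀} ∫₀ᵀ ∫_{B(x₀,1)} |∇v|² dx dt < ∞`. -/
  uniformLocalGradient : ∃ G : ℝ → EuclideanSpace ℝ (Fin 3) →
      EuclideanSpace ℝ (Fin 3) →L[ℝ] EuclideanSpace ℝ (Fin 3),
    HasWeakSpatialGradientOn (slab (EuclideanSpace ℝ (Fin 3)) (Ioo 0 T) isOpen_Ioo) v G ∧
    ∃ C : ℝ≥0, ∀ x₀ : EuclideanSpace ℝ (Fin 3),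
      ∫⁻ z in Ioo 0 T ×ˢ ball x₀ 1, ENNReal.ofReal (frobeniusNormSq (G z.1 z.2)) ≤ C
  /-- (B.1.6): weak continuity in time on the **closed** interval `[0, T]`:
  `t ↦ ∫ ⟪v(t), φ⟫` is continuous on `[0, T]` for every smooth compactly supported `φ`. -/
  weakContinuous : ∀ φ : EuclideanSpace ℝ (Fin 3) → EuclideanSpace ℝ (Fin 3),
    FunctionSpaces.IsTestFunctionOn (⊤ : Opens (EuclideanSpace ℝ (Fin 3))) φ →
      ContinuousOn (fun t => ∫ x, ⟪v t x, φ x⟫) (Icc 0 T)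
  /-- (B.1.7): the datum is attained in `L²_loc`: `∫_K |v(t) − v₀|² → 0` as `t → 0⁺`, `K`
  compact. -/
  initial : ∀ K : Set (EuclideanSpace ℝ (Fin 3)), IsCompact K →
    Tendsto (fun t => ∫⁻ x in K, ‖v t x - v₀ x‖ₑ ^ 2) (𝓝[>] 0) (𝓝 0)
  /-- Jia–Šverák's decay at spatial infinity (KMT Def. 3.2 (7)): `∫₀ᵀ ∫_{B_R(x₀)} |v|² → 0` as
  `|x₀| → ∞`, for every `R > 0`. -/
  decay : ∀ R : ℝ, 0 < R →
    Tendsto (fun x₀ : EuclideanSpace ℝ (Fin 3) => ∫⁻ z in Ioo 0 T ×ˢ ball x₀ R, ‖v z.1 z.2‖ₑ ^ 2)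
      (cocompact (EuclideanSpace ℝ (Fin 3))) (𝓝 0)

/-! ## Covering balls and compact sets by finitely many unit balls -/

/-- **A compact set is covered by finitely many unit balls** (compactness). [folklore] -/
theorem exists_finset_subset_biUnion_ball_one {K : Set (EuclideanSpace ℝ (Fin 3))}
    (hK : IsCompact K) :
    ∃ F : Finset (EuclideanSpace ℝ (Fin 3)), K ⊆ ⋃ c ∈ F, ball c 1 := by
  refine hK.elim_finite_subcover (fun c : EuclideanSpace ℝ (Fin 3) => ball c 1)
    (fun _ => isOpen_ball) fun x hx => ?_
  exact mem_iUnion.2 ⟨x, mem_ball_self one_pos⟩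

/-- **An `R`-ball is covered by finitely many unit balls, uniformly in its centre**: there is a
finite set `F` with `B(x₀, R) ⊆ ⋃_{c ∈ F} B(x₀ + c, 1)` for every `x₀` (a finite unit-ball cover
of the compact `B̄(0, R)`, translated). [folklore] -/
theorem exists_finset_ball_subset_biUnion_ball_one (R : ℝ) :
    ∃ F : Finset (EuclideanSpace ℝ (Fin 3)), ∀ x₀ : EuclideanSpace ℝ (Fin 3),
      ball x₀ R ⊆ ⋃ c ∈ F, ball (x₀ + c) 1 := by
  obtain ⟨F, hF⟩ := exists_finset_subset_biUnion_ball_one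
    (isCompact_closedBall (0 : EuclideanSpace ℝ (Fin 3)) R)
  refine ⟨F, fun x₀ y hy => ?_⟩
  have hmem : y - x₀ ∈ closedBall (0 : EuclideanSpace ℝ (Fin 3)) R := by
    rw [mem_closedBall_zero_iff]
    rw [mem_ball, dist_eq_norm] at hy
    exact hy.le
  obtain ⟨c, hc, hyc⟩ := mem_iUnion₂.1 (hF hmem)
  refine mem_iUnion₂.2 ⟨c, hc, ?_⟩
  rw [mem_ball, dist_eq_norm] at hyc ⊢
  have : y - (x₀ + c) = y - x₀ - c := by abel
  rwa [this]

/-- **Lower integrals over a finite union of sets are bounded by the sum**, here in the form: if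
each piece carries at most `C`, the union carries at most `card F · C`. [folklore] -/
theorem lintegral_biUnion_finset_le_card_mul {α : Type*} [MeasurableSpace α] {μ : Measure α}
    {ι : Type*} (F : Finset ι) (S : ι → Set α) (f : α → ℝ≥0∞) {C : ℝ≥0∞}
    (h : ∀ c ∈ F, ∫⁻ x in S c, f x ∂μ ≤ C) :
    ∫⁻ x in ⋃ c ∈ F, S c, f x ∂μ ≤ F.card * C := by
  classical
  induction F using Finset.induction_on with
  | empty => simp
  | @insert a s ha ih =>
    rw [Finset.set_biUnion_insert, Finset.card_insert_of_notMem ha, Nat.cast_add, Nat.cast_one,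
      add_mul, one_mul, add_comm ((s.card : ℝ≥0∞) * C)]
    refine (lintegral_union_le _ _ _).trans (add_le_add (h a (Finset.mem_insert_self a s)) ?_)
    exact ih fun c hc => h c (Finset.mem_insert_of_mem hc)

namespace IsLocalEnergySolutionOn

variable {T T' ν : ℝ} {v₀ : EuclideanSpace ℝ (Fin 3) → EuclideanSpace ℝ (Fin 3)}
  {v : ℝ → EuclideanSpace ℝ (Fin 3) → EuclideanSpace ℝ (Fin 3)}
  {π : ℝ → EuclideanSpace ℝ (Fin 3) → ℝ}

/-- A local energy solution is a distributional solution of Navier–Stokes on the open slab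
`(0, T) × ℝ³` ((B.1.5)). [cite: Seregin2014, Def. B.1 (B.1.5)] -/
theorem distributional (h : IsLocalEnergySolutionOn T ν v₀ v π) :
    IsDistributionalNSSolutionOn (slab (EuclideanSpace ℝ (Fin 3)) (Ioo 0 T) isOpen_Ioo) ν 0 v π :=
  h.suitable.distributional

/-- A local energy solution is jointly (a.e. strongly) measurable on the strip `(0, T) × ℝ³`
(it is locally integrable on the open slab). [folklore] -/
theorem aestronglyMeasurable (h : IsLocalEnergySolutionOn T ν v₀ v π) :
    AEStronglyMeasurable (uncurry v)
      (volume.restrict (Ioo (0 : ℝ) T ×ˢ (univ : Set (EuclideanSpace ℝ (Fin 3))))) :=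
  h.distributional.1.aestronglyMeasurable

/-- A local energy solution has a weak spatial gradient on the slab ((B.1.4)). [cite: Seregin2014, Def. B.1 (B.1.4)] -/
theorem exists_hasWeakSpatialGradientOn (h : IsLocalEnergySolutionOn T ν v₀ v π) :
    ∃ G, HasWeakSpatialGradientOn (slab (EuclideanSpace ℝ (Fin 3)) (Ioo 0 T) isOpen_Ioo) v G :=
  h.uniformLocalGradient.imp fun _ hG => hG.1

/-- Every slice `v t`, `t ∈ [0, T]`, of a local energy solution is square integrable on every
unit ball ((B.1.4) with (B.1.6)). [cite: Seregin2014, Def. B.1 (B.1.4)] -/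
theorem memLp_two_ball (h : IsLocalEnergySolutionOn T ν v₀ v π) {t : ℝ} (ht : t ∈ Icc 0 T)
    (x₀ : EuclideanSpace ℝ (Fin 3)) : MemLp (v t) 2 (volume.restrict (ball x₀ 1)) := by
  obtain ⟨C, hC⟩ := h.uniformLocalEnergy
  refine ⟨(h.sliceMeasurable t ht).restrict, ?_⟩
  rw [eLpNorm_lt_top_iff_lintegral_rpow_enorm_lt_top two_ne_zero ENNReal.ofNat_ne_top]
  have : ∫⁻ x in ball x₀ 1, ‖v t x‖ₑ ^ (2 : ℝ≥0∞).toReal = ∫⁻ x in ball x₀ 1, ‖v t x‖ₑ ^ 2 :=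
    lintegral_congr fun x => by rw [ENNReal.toReal_ofNat, ← ENNReal.rpow_natCast]; norm_num
  rw [this]
  exact (hC t ht x₀).trans_lt ENNReal.coe_lt_top

/-- Every slice `v t`, `t ∈ [0, T]`, of a local energy solution is locally integrable on `ℝ³`
(it is `L²`, hence `L¹`, on each unit ball). [folklore] -/
theorem locallyIntegrable_slice (h : IsLocalEnergySolutionOn T ν v₀ v π) {t : ℝ}
    (ht : t ∈ Icc 0 T) : LocallyIntegrable (v t) volume := by
  refine fun x₀ => ⟨ball x₀ 1, ball_mem_nhds x₀ one_pos, ?_⟩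
  have h2 := h.memLp_two_ball ht x₀
  haveI : IsFiniteMeasure (volume.restrict (ball x₀ (1 : ℝ))) :=
    ⟨by rw [Measure.restrict_apply_univ]; exact measure_ball_lt_top⟩
  exact (h2.mono_exponent (p := 1) (by norm_num)).integrable le_rfl

/-- The pairing `∫ ⟪v(t), φ⟫` of a slice, `t ∈ [0, T]`, with a continuous compactly supported
field is an honest (absolutely convergent) integral. [folklore] -/
theorem integrable_inner_slice (h : IsLocalEnergySolutionOn T ν v₀ v π) {t : ℝ} (ht : t ∈ Icc 0 T)
    {φ : EuclideanSpace ℝ (Fin 3) → EuclideanSpace ℝ (Fin 3)} (hφ : Continuous φ)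
    (hφc : HasCompactSupport φ) : Integrable (fun x => ⟪v t x, φ x⟫) volume :=
  integrable_inner_of_locallyIntegrable_of_hasCompactSupport (h.locallyIntegrable_slice ht) hφ hφc

/-- **The every-time unit-ball bound gives the bound on every `R`-ball**:
`∫_{B(x₀,R)} |v(t)|² ≤ N(R) · C` for all `t ∈ [0, T]` and `x₀` (finite cover of an `R`-ball by
unit balls, uniform in the centre). [folklore] -/
theorem exists_forall_lintegral_ball_le (h : IsLocalEnergySolutionOn T ν v₀ v π) (R : ℝ) :
    ∃ C : ℝ≥0, ∀ t ∈ Icc 0 T, ∀ x₀ : EuclideanSpace ℝ (Fin 3),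
      ∫⁻ x in ball x₀ R, ‖v t x‖ₑ ^ 2 ≤ C := by
  obtain ⟨C, hC⟩ := h.uniformLocalEnergy
  obtain ⟨F, hF⟩ := exists_finset_ball_subset_biUnion_ball_one R
  refine ⟨F.card * C, fun t ht x₀ => ?_⟩
  calc ∫⁻ x in ball x₀ R, ‖v t x‖ₑ ^ 2 ≤ ∫⁻ x in ⋃ c ∈ F, ball (x₀ + c) 1, ‖v t x‖ₑ ^ 2 :=
        lintegral_mono_set (hF x₀)
    _ ≤ F.card * (C : ℝ≥0∞) :=
        lintegral_biUnion_finset_le_card_mul F _ _ fun c _ => hC t ht (x₀ + c)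
    _ = ((F.card * C : ℝ≥0) : ℝ≥0∞) := by push_cast; rfl

/-- **Projection onto the slab class** (Def. B.1 ⇒ Kang–Miura–Tsai Def. 3.2 on `(0, T)`;
Kang–Miura–Tsai 2021, Lemma 3.3 direction "local energy ⇒ local Leray"): a local energy solution
on `ℝ³ × (0, T)` is a local Leray solution on the slab in the sense of `IsLocalLeraySolutionOn`
(`LocalLeraySolutionsSlab.lean`). The clauses to supply are the square integrability on
`(0, T) × K` (Tonelli and a finite unit-ball cover of the compact `K`), the uniform energy bound
for every radius `R` (finite cover of an `R`-ball, for a.e. — indeed every — `t ∈ (0, T)`) and the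
gradient bound for every `R` (the same cover in space–time); the rest are fields.
[cite: KangMiuraTsai2020, Lemma 3.3 (local energy solutions are local Leray solutions)] -/
theorem isLocalLeraySolutionOn (h : IsLocalEnergySolutionOn T ν v₀ v π) :
    IsLocalLeraySolutionOn T ν v₀ v π := by
  obtain ⟨G, hG, CG, hCG⟩ := h.uniformLocalGradient
  refine ⟨h.suitable, fun K hK => ?_, h.pressure, fun R hR => ?_, ⟨G, hG, fun R hR => ?_⟩,
    h.initial, h.decay⟩
  · -- `v ∈ L²((0, T) × K)`: Tonelli and the cover of `K` by finitely many unit balls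
    rcases le_or_gt T 0 with hT | hT
    · simp [Ioo_eq_empty_of_le hT]
    obtain ⟨C, hC⟩ := h.uniformLocalEnergy
    obtain ⟨F, hF⟩ := exists_finset_subset_biUnion_ball_one hK
    have hslice : ∀ t ∈ Ioo 0 T, ∫⁻ x in K, ‖v t x‖ₑ ^ 2 ≤ F.card * C := fun t ht =>
      (lintegral_mono_set hF).trans
        (lintegral_biUnion_finset_le_card_mul F _ _ fun c _ => hC t ⟨ht.1.le, ht.2.le⟩ c)
    have hmeas : AEMeasurable (fun z : ℝ × EuclideanSpace ℝ (Fin 3) => ‖v z.1 z.2‖ₑ ^ 2)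
        (((volume : Measure ℝ).prod (volume : Measure (EuclideanSpace ℝ (Fin 3)))).restrict
          (Ioo 0 T ×ˢ K)) := by
      have h1 : AEStronglyMeasurable (uncurry v) (volume.restrict (Ioo (0 : ℝ) T ×ˢ K)) :=
        h.aestronglyMeasurable.mono_measure
          (Measure.restrict_mono (Set.prod_mono Subset.rfl (subset_univ K)) le_rfl)
      rw [← Measure.volume_eq_prod]
      exact (h1.aemeasurable.enorm.pow_const 2)
    calc ∫⁻ z in Ioo 0 T ×ˢ K, ‖v z.1 z.2‖ₑ ^ 2
        = ∫⁻ t in Ioo 0 T, ∫⁻ x in K, ‖v t x‖ₑ ^ 2 := by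
          rw [Measure.volume_eq_prod, setLIntegral_prod _ hmeas]
      _ ≤ ∫⁻ _ in Ioo (0 : ℝ) T, (F.card : ℝ≥0∞) * C :=
          setLIntegral_mono measurable_const fun t ht => hslice t ht
      _ < ∞ := by
          rw [setLIntegral_const, Real.volume_Ioo]
          exact ENNReal.mul_lt_top (ENNReal.mul_lt_top (ENNReal.natCast_lt_top _)
            ENNReal.coe_lt_top) ENNReal.ofReal_lt_top
  · -- the uniform energy bound for radius `R`, at every (hence a.e.) time
    obtain ⟨C, hC⟩ := h.exists_forall_lintegral_ball_le R
    exact ⟨C, (ae_restrict_mem measurableSet_Ioo).mono fun t ht x₀ => hC t ⟨ht.1.le, ht.2.le⟩ x₀⟩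
  · -- the gradient bound for radius `R`
    obtain ⟨F, hF⟩ := exists_finset_ball_subset_biUnion_ball_one R
    refine ⟨F.card * CG, fun x₀ => ?_⟩
    calc ∫⁻ z in Ioo 0 T ×ˢ ball x₀ R, ENNReal.ofReal (frobeniusNormSq (G z.1 z.2))
        ≤ ∫⁻ z in ⋃ c ∈ F, Ioo 0 T ×ˢ ball (x₀ + c) 1,
            ENNReal.ofReal (frobeniusNormSq (G z.1 z.2)) := by
          refine lintegral_mono_set fun z hz => ?_
          obtain ⟨c, hc, hzc⟩ := mem_iUnion₂.1 (hF x₀ hz.2)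
          exact mem_iUnion₂.2 ⟨c, hc, hz.1, hzc⟩
      _ ≤ F.card * (CG : ℝ≥0∞) := lintegral_biUnion_finset_le_card_mul F _ _ fun c _ => hCG (x₀ + c)
      _ = ((F.card * CG : ℝ≥0) : ℝ≥0∞) := by push_cast; rfl

/-- **Restriction to a shorter strip.** A local energy solution on `ℝ³ × (0, T)` is one on
`ℝ³ × (0, T')` for `T' ≤ T`: suitability restricts to the smaller open slab
(`IsSuitableWeakSolutionOn.of_le`), all bounds and the decay are monotone in the time interval,
and (B.1.6) on `[0, T'] ⊆ [0, T]`. (Restarting from a *later* initial time `t₀ > 0` is a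
different matter — it needs `L²_loc`-continuity at `t₀`, cf. Seregin 2014, Remark B.4 — and is
not asserted here.) [folklore] -/
theorem mono (h : IsLocalEnergySolutionOn T ν v₀ v π) (hle : T' ≤ T) :
    IsLocalEnergySolutionOn T' ν v₀ v π := by
  have hI : Ioo (0 : ℝ) T' ⊆ Ioo 0 T := Ioo_subset_Ioo_right hle
  have hIcc : Icc (0 : ℝ) T' ⊆ Icc 0 T := Icc_subset_Icc_right hle
  have hslab : slab (EuclideanSpace ℝ (Fin 3)) (Ioo 0 T') isOpen_Ioo ≤
      slab (EuclideanSpace ℝ (Fin 3)) (Ioo 0 T) isOpen_Ioo := slab_mono hI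
  have hprod : ∀ K : Set (EuclideanSpace ℝ (Fin 3)), Ioo (0 : ℝ) T' ×ˢ K ⊆ Ioo 0 T ×ˢ K :=
    fun K => Set.prod_mono hI Subset.rfl
  obtain ⟨C, hC⟩ := h.uniformLocalEnergy
  obtain ⟨G, hG, C', hC'⟩ := h.uniformLocalGradient
  exact
    { suitable := h.suitable.of_le hslab
      pressure := fun K hK => lt_of_le_of_lt (lintegral_mono_set (hprod K)) (h.pressure K hK)
      sliceMeasurable := fun t ht => h.sliceMeasurable t (hIcc ht)
      uniformLocalEnergy := ⟨C, fun t ht x₀ => hC t (hIcc ht) x₀⟩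
      uniformLocalGradient := ⟨G, hG.mono hslab, C', fun x₀ =>
        (lintegral_mono_set (hprod _)).trans (hC' x₀)⟩
      weakContinuous := fun φ hφ => (h.weakContinuous φ hφ).mono hIcc
      initial := h.initial
      decay := fun R hR => by
        refine tendsto_of_tendsto_of_tendsto_of_le_of_le tendsto_const_nhds (h.decay R hR)
          (fun _ => bot_le) fun _ => lintegral_mono_set (hprod _) }

end IsLocalEnergySolutionOn

/-! ## Non-vacuity: the trivial flow -/

/-- **Non-vacuity.** The trivial flow `(v, π) = (0, 0)` is a local energy solution on every
strip `ℝ³ × (0, T)` with datum `0` (for any viscosity): all energies vanish and all pairings are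
the constant `0`. [folklore] -/
theorem isLocalEnergySolutionOn_zero (T ν : ℝ) :
    IsLocalEnergySolutionOn T ν (0 : EuclideanSpace ℝ (Fin 3) → EuclideanSpace ℝ (Fin 3))
      (0 : ℝ → EuclideanSpace ℝ (Fin 3) → EuclideanSpace ℝ (Fin 3))
      (0 : ℝ → EuclideanSpace ℝ (Fin 3) → ℝ) where
  suitable := isSuitableWeakSolutionOn_zero _ ν
  pressure K _ := by
    simp only [Pi.zero_apply, enorm_zero]
    rw [ENNReal.zero_rpow_of_pos (by norm_num)]
    simp
  sliceMeasurable _ _ := aestronglyMeasurable_const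
  uniformLocalEnergy := ⟨0, fun t _ x₀ => by simp⟩
  uniformLocalGradient := ⟨0, hasWeakSpatialGradientOn_zero _, 0, fun x₀ => by
    simp [frobeniusNormSq_zero]⟩
  weakContinuous φ _ := by
    simpa using (continuousOn_const : ContinuousOn (fun _ : ℝ => (0 : ℝ)) (Icc 0 T))
  initial K _ := by simp
  decay R _ := by simp

end Literature.Analysis.FluidPDE

end
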